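import Mathlib
import HarnessLib

/-!
# The worst-sector figure `F₂`: reference sets, the common-set comparator, and the
# self-reference asymmetry

HONEST FRAMING: exact (Metropolis-corrected) sampling algorithms for lattice gauge theory;
figures of merit are autocorrelation/cost numbers at stated couplings and volumes; no
continuum-physics claim.

Venture `LatticeQCDFlow` (cell pub-lqcd), sub-topic `Scoring`; FANOUT row 11 (`eng-scorerA`,
fitness scorer A).  NEW WORK of the cell (elementary order facts about a finite minimum), not a
published result; nothing is cited as a fact.  Companion of `PooledESS` (pooled vs per-sector Kish
ESS) — this file is about WHICH sectors enter the per-sector minimum.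

## Content

FITNESS §1 defines the worst-sector figure of a scored run as

  `F₂ = ESS_min / C_total`,   `ESS_min = min_{k ∈ R} ESS_k`,

where `R` is the REFERENCE SET of topological sectors: the sectors `k` whose reference weight is
at least the floor `θ = 1 %` (`refSet`).  The reference weights are the EXACT sector weights where
an oracle has them (2-d U(1)); otherwise — every 4-d SU(N) row today — the run's OWN measured
weights ('self-referenced', token `V3:sectors-self-referenced`), so that `R` depends on the run.
The lemmas below are the bookkeeping behind row 11's A-side statement on the reproduction lane
(HOME/eng-scorera/F2-REFERENCE-SECTORS-A.md, 2026-08-21):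

* `essMin_le`, `le_essMin_iff` — `ESS_min` is below every member's ESS and is the largest such
  number;
* `essMin_anti_set` — **shrinking the reference set can only raise the minimum**; hence the
  board-side 'common-set comparator' `γ₂ = min over R ∩ R'` of a record/reproduction pair is never
  below either row's own `ESS_min` (`essMin_le_essMin_inter_left/right`) and coincides with both
  when `R = R'` (`essMin_inter_self`) — monotone PER ROW; the original gloss here, 'it cannot
  manufacture a disagreement that `F₂` itself does not show', is FALSE per pair and is corrected
  in § 'Monotone per row, NOT per pair' at the end of this file (row 12's F20-4);
* `essMin_insert_of_lt`, `essMin_insert_lt` — **the self-reference asymmetry**: a run that reaches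
  one extra sector `k₀` with a small effective count (`ESS_{k₀} < ESS_min`) scores the strictly
  smaller figure `ESS_{k₀}`, while a run that never reaches `k₀` keeps its old minimum — under
  self-reference, blindness to a rare sector is rewarded (the ns112 record/reproduction pair of
  REPRO-F1.md: reference sets `{−2…2}` vs `{−2…3}` from a five-sample visit to `k = 3`);
* `essMin_eq_zero_of_mem` — with exact references, a reference sector ABSENT from the sample
  (ESS `0`, all ESS nonnegative) forces `ESS_min = 0`, i.e. `F₂ = 0` (token `V3:sector-absent`);
* `refSet_anti_floor`, `refSet_congr` — the reference set shrinks as the floor rises and depends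
  on the weights only through their values on the candidate sectors (so EXACT weights give a
  run-independent set);
* `F2_le_F2_inter` — the same comparator inequality after division by the (positive) cost.
-/

namespace Summit.Ventures.LatticeQCDFlow.Scoring

open Finset

variable {κ : Type*}

/-! ### The reference set -/

/-- The reference set at floor `θ`: the candidate sectors `k ∈ S` whose reference weight `π k`
is at least `θ` (FITNESS: `θ = 1/100`; `π` = exact sector weights where known, else the run's own
measured weights). -/
noncomputable def refSet (S : Finset κ) (π : κ → ℝ) (θ : ℝ) : Finset κ :=
  S.filter fun k => θ ≤ π k

/-- Membership in the reference set. -/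
theorem mem_refSet {S : Finset κ} {π : κ → ℝ} {θ : ℝ} {k : κ} :
    k ∈ refSet S π θ ↔ k ∈ S ∧ θ ≤ π k := by
  simp [refSet]

/-- The reference set is contained in the candidate set. -/
theorem refSet_subset (S : Finset κ) (π : κ → ℝ) (θ : ℝ) : refSet S π θ ⊆ S :=
  filter_subset _ _

/-- **Raising the floor shrinks the reference set.** -/
theorem refSet_anti_floor (S : Finset κ) (π : κ → ℝ) {θ θ' : ℝ} (h : θ ≤ θ') :
    refSet S π θ' ⊆ refSet S π θ := by
  intro k hk
  rw [mem_refSet] at hk ⊢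
  exact ⟨hk.1, h.trans hk.2⟩

/-- The reference set depends on the weights only through their values on the candidates: two
weight assignments that agree on `S` (e.g. two runs scored against the SAME exact weights) give
the same set. -/
theorem refSet_congr {S : Finset κ} {π π' : κ → ℝ} (h : ∀ k ∈ S, π k = π' k) (θ : ℝ) :
    refSet S π θ = refSet S π' θ := by
  ext k
  simp only [mem_refSet]
  constructor
  · rintro ⟨hk, hθ⟩; exact ⟨hk, h k hk ▸ hθ⟩
  · rintro ⟨hk, hθ⟩; exact ⟨hk, (h k hk).symm ▸ hθ⟩

/-! ### The worst-sector minimum -/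

/-- The worst-sector effective sample size over a nonempty reference set `R`:
`ESS_min = min_{k ∈ R} ess k`.  (`F₂ = essMin / C_total`.) -/
noncomputable def essMin (R : Finset κ) (hR : R.Nonempty) (ess : κ → ℝ) : ℝ :=
  R.inf' hR ess

/-- `ESS_min` is at most the ESS of every reference sector. -/
theorem essMin_le {R : Finset κ} (hR : R.Nonempty) (ess : κ → ℝ) {k : κ} (hk : k ∈ R) :
    essMin R hR ess ≤ ess k :=
  inf'_le ess hk

/-- `m ≤ ESS_min` iff `m` is below every reference sector's ESS. -/
theorem le_essMin_iff {R : Finset κ} (hR : R.Nonempty) (ess : κ → ℝ) {m : ℝ} :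
    m ≤ essMin R hR ess ↔ ∀ k ∈ R, m ≤ ess k :=
  le_inf'_iff hR ess

/-- `ESS_min` is attained: some reference sector carries it (the row's `F2_k_min`). -/
theorem exists_mem_eq_essMin {R : Finset κ} (hR : R.Nonempty) (ess : κ → ℝ) :
    ∃ k ∈ R, ess k = essMin R hR ess := by
  obtain ⟨k, hk, h⟩ := exists_mem_eq_inf' hR ess
  exact ⟨k, hk, h.symm⟩

/-- Nonnegative per-sector ESS gives a nonnegative minimum. -/
theorem essMin_nonneg {R : Finset κ} (hR : R.Nonempty) {ess : κ → ℝ} (h : ∀ k ∈ R, 0 ≤ ess k) :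
    0 ≤ essMin R hR ess :=
  (le_essMin_iff hR ess).2 h

/-- Pointwise larger per-sector ESS gives a larger minimum. -/
theorem essMin_mono_fun {R : Finset κ} (hR : R.Nonempty) {ess ess' : κ → ℝ}
    (h : ∀ k ∈ R, ess k ≤ ess' k) : essMin R hR ess ≤ essMin R hR ess' :=
  (le_essMin_iff hR ess').2 fun k hk => (essMin_le hR ess hk).trans (h k hk)

/-- **Shrinking the reference set can only raise the minimum**: `R' ⊆ R` gives
`ESS_min(R) ≤ ESS_min(R')`. -/
theorem essMin_anti_set {R R' : Finset κ} (hR' : R'.Nonempty) (h : R' ⊆ R) (ess : κ → ℝ) :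
    essMin R (hR'.mono h) ess ≤ essMin R' hR' ess :=
  inf'_mono ess h hR'

/-! ### The common-set comparator `γ₂` of a record/reproduction pair -/

section DecEq

variable [DecidableEq κ]

/-- The comparator over the common set is never below the record's own minimum. -/
theorem essMin_le_essMin_inter_left {R R' : Finset κ} (h : (R ∩ R').Nonempty) (ess : κ → ℝ) :
    essMin R (h.mono inter_subset_left) ess ≤ essMin (R ∩ R') h ess :=
  essMin_anti_set h inter_subset_left ess

/-- The comparator over the common set is never below the reproduction's own minimum. -/
theorem essMin_le_essMin_inter_right {R R' : Finset κ} (h : (R ∩ R').Nonempty) (ess : κ → ℝ) :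
    essMin R' (h.mono inter_subset_right) ess ≤ essMin (R ∩ R') h ess :=
  essMin_anti_set h inter_subset_right ess

/-- Equal reference sets: the comparator IS the row's own minimum. -/
theorem essMin_inter_self {R : Finset κ} (hR : R.Nonempty) (ess : κ → ℝ) :
    essMin (R ∩ R) (by rwa [inter_self]) ess = essMin R hR ess := by
  unfold essMin
  exact inf'_congr _ (inter_self R) (fun _ _ => rfl)

/-- If the common set still contains a sector where the row's own minimum is attained, the
comparator equals that minimum (nothing is discarded for this row). -/
theorem essMin_inter_eq_of_argmin_mem {R R' : Finset κ} (h : (R ∩ R').Nonempty) (ess : κ → ℝ)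
    {k : κ} (hk : k ∈ R ∩ R') (hmin : ess k = essMin R (h.mono inter_subset_left) ess) :
    essMin (R ∩ R') h ess = essMin R (h.mono inter_subset_left) ess :=
  le_antisymm (hmin ▸ essMin_le h ess hk) (essMin_le_essMin_inter_left h ess)

/-! ### The self-reference asymmetry -/

/-- Reaching one more sector: the new minimum is `min (ess k₀) (old minimum)`. -/
theorem essMin_insert {R : Finset κ} (hR : R.Nonempty) (ess : κ → ℝ) (k₀ : κ) :
    essMin (insert k₀ R) (insert_nonempty k₀ R) ess = min (ess k₀) (essMin R hR ess) := by
  refine le_antisymm (le_min (essMin_le _ ess (mem_insert_self k₀ R))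
    (essMin_anti_set hR (subset_insert k₀ R) ess)) ((le_essMin_iff _ ess).2 fun k hk => ?_)
  rcases mem_insert.1 hk with rfl | hk
  · exact min_le_left _ _
  · exact (min_le_right _ _).trans (essMin_le hR ess hk)

/-- **A rarely-visited extra sector takes over the minimum**: if `ess k₀ < ESS_min(R)` then
`ESS_min(R ∪ {k₀}) = ess k₀`. -/
theorem essMin_insert_of_lt {R : Finset κ} (hR : R.Nonempty) (ess : κ → ℝ)
    {k₀ : κ} (hlt : ess k₀ < essMin R hR ess) :
    essMin (insert k₀ R) (insert_nonempty k₀ R) ess = ess k₀ := by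
  rw [essMin_insert hR ess k₀, min_eq_left hlt.le]

/-- **Blindness is rewarded under self-reference**: the run that reaches `k₀` with
`ess k₀ < ESS_min(R)` scores STRICTLY less than the run that never reaches it. -/
theorem essMin_insert_lt {R : Finset κ} (hR : R.Nonempty) (ess : κ → ℝ)
    {k₀ : κ} (hlt : ess k₀ < essMin R hR ess) :
    essMin (insert k₀ R) (insert_nonempty k₀ R) ess < essMin R hR ess := by
  rw [essMin_insert_of_lt hR ess hlt]; exact hlt

/-- In any case reaching an extra sector never RAISES the figure. -/
theorem essMin_insert_le {R : Finset κ} (hR : R.Nonempty) (ess : κ → ℝ)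
    (k₀ : κ) : essMin (insert k₀ R) (insert_nonempty k₀ R) ess ≤ essMin R hR ess :=
  essMin_anti_set hR (subset_insert k₀ R) ess

end DecEq

/-! ### Absent reference sector (exact references) -/

/-- With nonnegative ESS, a reference sector of ESS `0` (absent from the sample) forces
`ESS_min = 0`, i.e. `F₂ = 0`. -/
theorem essMin_eq_zero_of_mem {R : Finset κ} (hR : R.Nonempty) {ess : κ → ℝ}
    (h0 : ∀ k ∈ R, 0 ≤ ess k) {k : κ} (hk : k ∈ R) (habs : ess k = 0) :
    essMin R hR ess = 0 :=
  le_antisymm (habs ▸ essMin_le hR ess hk) (essMin_nonneg hR h0)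

/-! ### In `F₂` units -/

/-- The worst-sector figure `F₂ = ESS_min / C_total`. -/
noncomputable def F2 (R : Finset κ) (hR : R.Nonempty) (ess : κ → ℝ) (C : ℝ) : ℝ :=
  essMin R hR ess / C

/-- Division by a positive cost preserves the comparator inequality: a row's own `F₂` is at most
its common-set value (same cost on both sides — the comparator is computed PER ROW). -/
theorem F2_le_F2_inter [DecidableEq κ] {R R' : Finset κ} (h : (R ∩ R').Nonempty) (ess : κ → ℝ) {C : ℝ}
    (hC : 0 < C) :
    F2 R (h.mono inter_subset_left) ess C ≤ F2 (R ∩ R') h ess C :=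
  div_le_div_of_nonneg_right (essMin_le_essMin_inter_left h ess) hC.le

/-- `F₂ = 0` exactly when `ESS_min = 0` (positive cost). -/
theorem F2_eq_zero_iff {R : Finset κ} (hR : R.Nonempty) (ess : κ → ℝ) {C : ℝ} (hC : 0 < C) :
    F2 R hR ess C = 0 ↔ essMin R hR ess = 0 := by
  rw [F2, div_eq_zero_iff, or_iff_left hC.ne']

/-! ### Monotone per row, NOT per pair (row 12's F20-4, 2026-08-21)

CORRECTION OF RECORD.  The module docstring as landed with p256794 glossed
`essMin_le_essMin_inter_left/right` + `essMin_inter_self` as 'it cannot manufacture a disagreement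
that `F₂` itself does not show' (the bullet now points here), and row 11's INBOX line of
2026-08-21T08:39:51Z said the same in its condition (ii).  Row 12 (eng-scorerb, F20-4, INBOX 2026-08-21T08:46:18Z) pointed out that this
is FALSE as a literal statement about a record/reproduction PAIR: the comparator raises each row's
value (`F2c ≥ F₂`, monotone PER ROW) but the two rows are raised by different amounts, so the GAP
between them — and hence the reproduction `z` — can move EITHER way.  Live instance: LEADERBOARD
pair ns28, raw-`F₂` z 0.58 → γ₂ z 1.16, because the reproduction's own argmin (sector `−3`) lies
outside the common set, so its value rises while the record's does not (eng-board folded the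
corrected wording into board 0.1.13: 'monotone per row, not per pair; z(γ₂) can exceed z(raw)').

What IS true per pair: when the reference sets coincide the comparator gap equals the raw gap
(`comparatorGap_eq_rawGap_of_eq`), and more generally whenever BOTH rows still attain their own
minimum inside the common set (`comparatorGap_eq_rawGap_of_argmin_mem`).  What is false: any
pairwise domination in either direction — `exists_rawGap_lt_comparatorGap` (the comparator
manufactures a gap of `4` where raw `F₂` agrees exactly) and `exists_comparatorGap_lt_rawGap` (the
comparator hides a raw gap of `9` completely).  Both witnesses live on three sectors `{0, 1, 2} ⊆ ℕ`
with record set `{0, 1}` and reproduction set `{0, 1, 2}` — the shape of every self-referenced pair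
in which one run reaches one sector more than the other. -/

section PerPair

variable [DecidableEq κ]

/-- The raw gap of a pair: `|ESS_min(R, ess) − ESS_min(R', ess')|` (record vs reproduction, each on
its own reference set). -/
noncomputable def rawGap (R R' : Finset κ) (hR : R.Nonempty) (hR' : R'.Nonempty)
    (ess ess' : κ → ℝ) : ℝ :=
  |essMin R hR ess - essMin R' hR' ess'|

/-- The comparator gap of a pair: both rows evaluated on the common set `R ∩ R'`. -/
noncomputable def comparatorGap (R R' : Finset κ) (h : (R ∩ R').Nonempty) (ess ess' : κ → ℝ) : ℝ :=
  |essMin (R ∩ R') h ess - essMin (R ∩ R') h ess'|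

/-- Equal reference sets: the comparator gap IS the raw gap (γ₂ ≡ `F₂`, nothing moves). -/
theorem comparatorGap_eq_rawGap_of_eq {R R' : Finset κ} (hRR' : R = R') (hR : R.Nonempty)
    (ess ess' : κ → ℝ) :
    comparatorGap R R' (by subst hRR'; rwa [inter_self]) ess ess' =
      rawGap R R' hR (hRR' ▸ hR) ess ess' := by
  subst hRR'
  simp only [comparatorGap, rawGap, essMin_inter_self hR]

/-- If BOTH rows attain their own minimum at a sector of the common set, the comparator gap is the
raw gap (the only case in which γ₂ is guaranteed not to move the pair's `z`). -/
theorem comparatorGap_eq_rawGap_of_argmin_mem {R R' : Finset κ} (h : (R ∩ R').Nonempty)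
    (ess ess' : κ → ℝ) {k k' : κ} (hk : k ∈ R ∩ R') (hk' : k' ∈ R ∩ R')
    (hmin : ess k = essMin R (h.mono inter_subset_left) ess)
    (hmin' : ess' k' = essMin R' (h.mono inter_subset_right) ess') :
    comparatorGap R R' h ess ess' =
      rawGap R R' (h.mono inter_subset_left) (h.mono inter_subset_right) ess ess' := by
  have h1 := essMin_inter_eq_of_argmin_mem h ess hk hmin
  have h2 : essMin (R ∩ R') h ess' = essMin R' (h.mono inter_subset_right) ess' := by
    have hk'' : k' ∈ R' ∩ R := by rwa [inter_comm]
    have h' : (R' ∩ R).Nonempty := ⟨k', hk''⟩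
    have := essMin_inter_eq_of_argmin_mem h' ess' hk'' hmin'
    simpa only [essMin, inf'_congr h' (inter_comm R' R) (fun _ _ => rfl)] using this
  simp only [comparatorGap, rawGap, h1, h2]

/-- The three-sector witness: candidate sectors `0, 1, 2`; the record's reference set. -/
private def Rrec : Finset ℕ := {0, 1}
/-- The reproduction's reference set (it reached one sector more). -/
private def Rrep : Finset ℕ := {0, 1, 2}

/-- The common set of the witness pair is the record's set `{0, 1}`. -/
private lemma Rrec_inter_Rrep : Rrec ∩ Rrep = Rrec := by decide

/-- The record's set is nonempty. -/
private lemma Rrec_nonempty : Rrec.Nonempty := ⟨0, by simp [Rrec]⟩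
/-- The reproduction's set is nonempty. -/
private lemma Rrep_nonempty : Rrep.Nonempty := ⟨0, by simp [Rrep]⟩
/-- The common set is nonempty. -/
private lemma inter_nonempty : (Rrec ∩ Rrep).Nonempty := by
  rw [Rrec_inter_Rrep]; exact Rrec_nonempty

/-- Evaluate a minimum by exhibiting the argmin and checking the lower bound on every member. -/
private lemma essMin_eq_of_mem_of_le {R : Finset ℕ} (hR : R.Nonempty) (ess : ℕ → ℝ) {m : ℝ}
    {k : ℕ} (hk : k ∈ R) (hkm : ess k = m) (hle : ∀ j ∈ R, m ≤ ess j) : essMin R hR ess = m :=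
  le_antisymm (hkm ▸ essMin_le hR ess hk) ((le_essMin_iff hR ess).2 hle)

/-- **γ₂ can MANUFACTURE a disagreement (F20-4).**  Record: `ess 0 = 2`, `ess 1 = 5` on `{0,1}`
(`F₂`-minimum `2`).  Reproduction: `ess' 0 = ess' 1 = 6`, `ess' 2 = 2` on `{0,1,2}` (minimum `2`,
attained OUTSIDE the common set).  Raw gap `|2 − 2| = 0`; comparator gap on `{0,1}` is
`|2 − 6| = 4`. -/
theorem exists_rawGap_lt_comparatorGap :
    ∃ (R R' : Finset ℕ) (hR : R.Nonempty) (hR' : R'.Nonempty) (h : (R ∩ R').Nonempty)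
      (ess ess' : ℕ → ℝ),
      rawGap R R' hR hR' ess ess' = 0 ∧ comparatorGap R R' h ess ess' = 4 := by
  classical
  let ess : ℕ → ℝ := fun k => if k = 0 then 2 else 5
  let ess' : ℕ → ℝ := fun k => if k = 2 then 2 else 6
  have hrec : essMin Rrec Rrec_nonempty ess = 2 :=
    essMin_eq_of_mem_of_le _ ess (k := 0) (by simp [Rrec]) (by simp [ess]) (by
      intro j hj; simp only [Rrec, mem_insert, mem_singleton] at hj
      rcases hj with rfl | rfl <;> norm_num [ess])
  have hrep : essMin Rrep Rrep_nonempty ess' = 2 :=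
    essMin_eq_of_mem_of_le _ ess' (k := 2) (by simp [Rrep]) (by simp [ess']) (by
      intro j hj; simp only [Rrep, mem_insert, mem_singleton] at hj
      rcases hj with rfl | rfl | rfl <;> norm_num [ess'])
  have hrecc : essMin (Rrec ∩ Rrep) inter_nonempty ess = 2 :=
    essMin_eq_of_mem_of_le _ ess (k := 0) (by rw [Rrec_inter_Rrep]; simp [Rrec]) (by simp [ess]) (by
      intro j hj; rw [Rrec_inter_Rrep] at hj; simp only [Rrec, mem_insert, mem_singleton] at hj
      rcases hj with rfl | rfl <;> norm_num [ess])
  have hrepc : essMin (Rrec ∩ Rrep) inter_nonempty ess' = 6 :=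
    essMin_eq_of_mem_of_le _ ess' (k := 0) (by rw [Rrec_inter_Rrep]; simp [Rrec]) (by simp [ess']) (by
      intro j hj; rw [Rrec_inter_Rrep] at hj; simp only [Rrec, mem_insert, mem_singleton] at hj
      rcases hj with rfl | rfl <;> norm_num [ess'])
  refine ⟨Rrec, Rrep, Rrec_nonempty, Rrep_nonempty, inter_nonempty, ess, ess', ?_, ?_⟩
  · simp only [rawGap, hrec, hrep]; norm_num
  · simp only [comparatorGap, hrecc, hrepc]; norm_num

/-- **γ₂ can HIDE a disagreement.**  Record: `ess 0 = ess 1 = 10` on `{0,1}` (minimum `10`).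
Reproduction: `ess' 0 = ess' 1 = 10`, `ess' 2 = 1` on `{0,1,2}` (minimum `1`, attained outside the
common set).  Raw gap `|10 − 1| = 9`; comparator gap on `{0,1}` is `|10 − 10| = 0`. -/
theorem exists_comparatorGap_lt_rawGap :
    ∃ (R R' : Finset ℕ) (hR : R.Nonempty) (hR' : R'.Nonempty) (h : (R ∩ R').Nonempty)
      (ess ess' : ℕ → ℝ),
      rawGap R R' hR hR' ess ess' = 9 ∧ comparatorGap R R' h ess ess' = 0 := by
  classical
  let ess : ℕ → ℝ := fun _ => 10
  let ess' : ℕ → ℝ := fun k => if k = 2 then 1 else 10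
  have hrec : essMin Rrec Rrec_nonempty ess = 10 :=
    essMin_eq_of_mem_of_le _ ess (k := 0) (by simp [Rrec]) (by simp [ess]) (by
      intro j _; simp [ess])
  have hrep : essMin Rrep Rrep_nonempty ess' = 1 :=
    essMin_eq_of_mem_of_le _ ess' (k := 2) (by simp [Rrep]) (by simp [ess']) (by
      intro j hj; simp only [Rrep, mem_insert, mem_singleton] at hj
      rcases hj with rfl | rfl | rfl <;> norm_num [ess'])
  have hrecc : essMin (Rrec ∩ Rrep) inter_nonempty ess = 10 :=
    essMin_eq_of_mem_of_le _ ess (k := 0) (by rw [Rrec_inter_Rrep]; simp [Rrec]) (by simp [ess]) (by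
      intro j _; simp [ess])
  have hrepc : essMin (Rrec ∩ Rrep) inter_nonempty ess' = 10 :=
    essMin_eq_of_mem_of_le _ ess' (k := 0) (by rw [Rrec_inter_Rrep]; simp [Rrec]) (by simp [ess']) (by
      intro j hj; rw [Rrec_inter_Rrep] at hj; simp only [Rrec, mem_insert, mem_singleton] at hj
      rcases hj with rfl | rfl <;> norm_num [ess'])
  refine ⟨Rrec, Rrep, Rrec_nonempty, Rrep_nonempty, inter_nonempty, ess, ess', ?_, ?_⟩
  · simp only [rawGap, hrec, hrep]; norm_num
  · simp only [comparatorGap, hrecc, hrepc]; norm_num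

/-- **The literal sentence of condition (ii) is false**: there is NO pairwise domination
`comparatorGap ≤ rawGap` (row 12's F20-4), … -/
theorem not_comparatorGap_le_rawGap :
    ¬ ∀ (R R' : Finset ℕ) (hR : R.Nonempty) (hR' : R'.Nonempty) (h : (R ∩ R').Nonempty)
        (ess ess' : ℕ → ℝ), comparatorGap R R' h ess ess' ≤ rawGap R R' hR hR' ess ess' := by
  intro hall
  obtain ⟨R, R', hR, hR', h, ess, ess', h0, h4⟩ := exists_rawGap_lt_comparatorGap
  have := hall R R' hR hR' h ess ess'
  rw [h0, h4] at this
  norm_num at this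

/-- … and none the other way either: γ₂ is not a conservative (gap-shrinking) comparator. -/
theorem not_rawGap_le_comparatorGap :
    ¬ ∀ (R R' : Finset ℕ) (hR : R.Nonempty) (hR' : R'.Nonempty) (h : (R ∩ R').Nonempty)
        (ess ess' : ℕ → ℝ), rawGap R R' hR hR' ess ess' ≤ comparatorGap R R' h ess ess' := by
  intro hall
  obtain ⟨R, R', hR, hR', h, ess, ess', h9, h0⟩ := exists_comparatorGap_lt_rawGap
  have := hall R R' hR hR' h ess ess'
  rw [h9, h0] at this
  norm_num at this

end PerPair

end Summit.Ventures.LatticeQCDFlow.Scoring
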